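import Summits.KontsevichZagierPeriods.KontsevichZagierPeriods.Theorems.RootDecompWalshStrataQuadricShear

/-!
# Root decomposition & Walsh strata — the `z`-glue with affine walls (lens 4, gen 7, part F)

The `z`-glue `Quadric₃.inBaker_cell3` treats the cell `(0,1)³ ∩ {p > 0}` of a quadric normal form with a
square term (`A ≠ 0`): the fibre is `(0, 1) ∩ (lo, hi)` and the clamp regimes of the roots are decided
on the atoms of the adapted family `(D, C₀, C₁, B, 2A + B)`.  Here the constant fibre walls `0, 1` are
replaced by RATIONAL AFFINE WALLS `ℓ₁(x,y) ≤ ℓ₂(x,y)` over a base region `{g(x,y) > 0}` of the square: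

* `Wall`, `Quadric₃.shiftW ℓ` (the normal form of `p(x, y, w + ℓ(x,y))`: same `A`, same discriminant,
  roots shifted by `ℓ`), the regime iffs against a wall (`wall_lt_lo_iff`, `lo_lt_wall_iff`,
  `wall_lt_hi_iff`, `hi_lt_wall_iff` — signs of `p∘ℓ` and `2Aℓ + B`), the clamp `kap l u w` into `[l, u]`;
* the WALL FAMILY `Quadric₃.wfam ℓ₁ ℓ₂ g = (D, p∘ℓ₁, 2Aℓ₁ + B, p∘ℓ₂, 2Aℓ₂ + B, g)` of six conics and its
  sign atoms `atomFam` (on `{p∘ℓ = 0}` the discriminant is the square `(2Aℓ + B)²`: genus 0 persists);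
* `Quadric₃.inBaker_wallCell` — for `A ≠ 0`, `[(0,1)³ ∩ {g > 0} ∩ {ℓ₁ < z < ℓ₂} ∩ {p > 0}, q]` lands in the
  Baker sector modulo relations as soon as `[atom, γ√D] ∈ InBaker` for the atoms of the wall families of
  all normal forms (`A < 0`: band between the clamped roots, rule (3), partition over the atoms, per atom
  affine weights by `InBaker.quad_atomFam` plus `γ√D`; `A > 0`: complement in the wall box);
* `Quadric₃.inBaker_prismCell` — the prism cell of the shear move is two wall cells
  (`x < 1/2`: walls `1 − 2x < z < 1`; `x > 1/2`: walls `0 < z < 2 − 2x`) and a null plane;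
* `quadricBakerDescent_of_sqrtDescentW : hW → QuadricBakerDescent` — the route item
  (stmt-KontsevichZagierPeriods-27597) from the SINGLE residual kind
  `hW : ∀ L ℓ₁ ℓ₂ g γ σ, [atomFam (L.wfam ℓ₁ ℓ₂ g) σ, γ√D_L] ∈ InBaker`
  (the hypothesis `hS` of the cube glue is its sub-case `ℓ₁ = 0, ℓ₂ = 1, g = 1`).

References: [KontsevichZagier2001 §1.2 rules (1)–(3)], [BCR1998 §2.2], this node (NODE.md gen 7, B3).

This is part 1/4 (§31.1–31.2: `Wall`, `kap`, `Quadric₃.shiftW`, the root regimes against a wall);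
part 2/4 (`RootDecompWalshStrataQuadricWalls02`) = the wall family `Quadric₃.wfam`, its atoms, the base
region / wall box and `inBaker_wallBox`; part 3/4 (`…Walls03`) = `Quadric₃.wallCell` for `A < 0`, `A > 0`,
`A ≠ 0`; part 4/4 (`…Walls04`) = the prism split and `quadricBakerDescent_of_sqrtDescentW`.
-/

noncomputable section

open Literature.NumberTheory.Transcendental
open MeasureTheory Set
open MvPolynomial (aeval X C)
open Literature.ModelTheory.ExponentialFields (IsSemialgebraic isSemialgebraic_univ
  isSemialgebraic_setOf_eval_pos isSemialgebraic_setOf_eval_lt isSemialgebraic_setOf_eval_le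
  isSemialgebraic_setOf_eval_nonneg isSemialgebraic_setOf_eval_eq_zero
  isSemialgebraic_setOf_eval_ne_zero continuous_aeval_real tarski_seidenberg_real_holds)
open Summit.KontsevichZagierPeriods.RootDecompWalshStrata.WalshSpanProof (isSemialgebraic_cubeSet
  isBounded_cubeSet)
open Summit.KontsevichZagierPeriods.RootDecompWalshStrata.ConeSpecimen (unitIoo isSemialgebraic_unitIoo
  unitIoo_subset_Icc mem_unitIoo)
open Summit.KontsevichZagierPeriods.RootDecompWalshStrata.PointlessOctant (boxTwo isSemialgebraic_boxTwo
  boxTwo_subset_Icc)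

namespace Summit.KontsevichZagierPeriods.RootDecompWalshStrata.ConicDescent.BallCube

/-! #### 31.1 Affine walls, the clamp into `[l, u]`, the shifted normal form -/

/-- A rational affine form `k₀ + k₁ x + k₂ y` (a WALL `z = ℓ(x, y)`, or a base constraint `g > 0`). -/
structure Wall where
  /-- constant coefficient -/
  k0 : ℚ
  /-- coefficient of `x` -/
  k1 : ℚ
  /-- coefficient of `y` -/
  k2 : ℚ

namespace Wall

variable (ℓ : Wall)

/-- Evaluation `ℓ(x, y) = k₀ + k₁ x + k₂ y`. -/
def eval (x y : ℝ) : ℝ := ℓ.k0 + ℓ.k1 * x + ℓ.k2 * y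

/-- The wall as an (affine) conic. -/
def toConic : Conic := ⟨0, ℓ.k2, 0, ℓ.k0, ℓ.k1, 0⟩

/-- The conic of a wall evaluates to the wall. [this node] -/
theorem toConic_pxy (x y : ℝ) : ℓ.toConic.pxy x y = ℓ.eval x y := by
  simp only [toConic, Conic.pxy, Conic.Bx, Conic.Cx, eval]; push_cast; ring

/-- The linear combination `a ℓ₁ + b ℓ₂` of two walls. -/
def lin (a : ℚ) (ℓ₁ : Wall) (b : ℚ) (ℓ₂ : Wall) : Wall :=
  ⟨a * ℓ₁.k0 + b * ℓ₂.k0, a * ℓ₁.k1 + b * ℓ₂.k1, a * ℓ₁.k2 + b * ℓ₂.k2⟩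

/-- Evaluation of a linear combination. [this node] -/
theorem lin_eval (a : ℚ) (ℓ₁ : Wall) (b : ℚ) (ℓ₂ : Wall) (x y : ℝ) :
    (lin a ℓ₁ b ℓ₂).eval x y = a * ℓ₁.eval x y + b * ℓ₂.eval x y := by
  simp only [lin, eval]; push_cast; ring

/-- The wall as a polynomial in three variables (ignoring `z`). -/
def P3 : MvPolynomial (Fin 3) ℚ := C ℓ.k0 + C ℓ.k1 * X 0 + C ℓ.k2 * X 1

/-- Evaluation of `P3`. [this node] -/
@[simp] theorem aeval_P3 (z : Fin 3 → ℝ) : aeval z ℓ.P3 = ℓ.eval (z 0) (z 1) := by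
  simp only [P3, eval, map_add, map_mul, MvPolynomial.aeval_C, MvPolynomial.aeval_X, eq_ratCast]

/-- A wall is a `ℚ`-semialgebraic function on any `ℚ`-semialgebraic subset of the plane. [BCR1998 §2.2] -/
theorem isSemialgebraicFunOn_eval {X : Set (Fin 2 → ℝ)} (hX : IsSemialgebraic ℚ X) :
    IsSemialgebraicFunOn ℚ X fun v => ℓ.eval (v 0) (v 1) :=
  (isSemialgebraicFunOn_aeval hX ℓ.toConic.pxyP).congr fun v _ => by
    simp only [Conic.aeval_pxyP, toConic_pxy]

end Wall

/-- `max a b = (a + b + |a − b|)/2`. [folklore] (PRIVATE: landed twins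
`…AccessibleCornerStokesYFibreDeriv.min_eq_half` & co., gate lint `dedup.landed`.) -/
private theorem max_eq_half_abs (a b : ℝ) : max a b = (a + b + |a - b|) / 2 := by
  rcases le_total a b with h | h
  · rw [max_eq_right h, abs_of_nonpos (sub_nonpos.2 h)]; ring
  · rw [max_eq_left h, abs_of_nonneg (sub_nonneg.2 h)]; ring

/-- `min a b = (a + b − |a − b|)/2`. [folklore] (PRIVATE: landed twins
`…AccessibleCornerStokesYFibreDeriv.min_eq_half` & co., gate lint `dedup.landed`.) -/
private theorem min_eq_half_abs (a b : ℝ) : min a b = (a + b - |a - b|) / 2 := by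
  rcases le_total a b with h | h
  · rw [min_eq_left h, abs_of_nonpos (sub_nonpos.2 h)]; ring
  · rw [min_eq_right h, abs_of_nonneg (sub_nonneg.2 h)]; ring

/-- The clamp of `w` into `[l, u]`: `κ_{l,u}(w) = max l (min u w)`. -/
def kap (l u w : ℝ) : ℝ := max l (min u w)

/-- `κ(w) = l` for `w ≤ l`. [folklore] -/
theorem kap_of_le_left {l u w : ℝ} (h : w ≤ l) : kap l u w = l :=
  max_eq_left ((min_le_right _ _).trans h)

/-- `κ(w) = u` for `u ≤ w` (`l ≤ u`). [folklore] -/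
theorem kap_of_right_le {l u w : ℝ} (h : u ≤ w) (hlu : l ≤ u) : kap l u w = u := by
  unfold kap; rw [min_eq_left h, max_eq_right hlu]

/-- `κ(w) = w` for `l ≤ w ≤ u`. [folklore] -/
theorem kap_of_mem {l u w : ℝ} (h1 : l ≤ w) (h2 : w ≤ u) : kap l u w = w := by
  unfold kap; rw [min_eq_right h2, max_eq_right h1]

/-- `l ≤ κ(w)`. [folklore] -/
theorem le_kap (l u w : ℝ) : l ≤ kap l u w := le_max_left _ _

/-- `κ(w) ≤ u` (`l ≤ u`). [folklore] -/
theorem kap_le {l u : ℝ} (hlu : l ≤ u) (w : ℝ) : kap l u w ≤ u := max_le hlu (min_le_left _ _)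

/-- `κ` is monotone. [folklore] -/
theorem kap_mono (l u : ℝ) {a b : ℝ} (h : a ≤ b) : kap l u a ≤ kap l u b :=
  max_le_max le_rfl (min_le_min le_rfl h)

/-- For `y ∈ (l, u)`: `κ(t) < y ↔ t < y`. [folklore] -/
theorem kap_lt_iff {l u t y : ℝ} (hy0 : l < y) (hy1 : y < u) : kap l u t < y ↔ t < y := by
  unfold kap
  rw [max_lt_iff, min_lt_iff]
  constructor
  · rintro ⟨-, h | h⟩
    · exact absurd h (not_lt.2 hy1.le)
    · exact h
  · exact fun h => ⟨hy0, Or.inr h⟩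

/-- For `y ∈ (l, u)`: `y < κ(t) ↔ y < t`. [folklore] -/
theorem lt_kap_iff {l u t y : ℝ} (hy0 : l < y) (hy1 : y < u) : y < kap l u t ↔ y < t := by
  unfold kap
  rw [lt_max_iff, lt_min_iff]
  constructor
  · rintro (h | ⟨-, h⟩)
    · exact absurd h (not_lt.2 hy0.le)
    · exact h
  · exact fun h => Or.inr ⟨hy1, h⟩

/-- The clamp of semialgebraic functions between semialgebraic walls is semialgebraic
(`max`/`min` via `|·|`). [BCR1998 §2.2] -/
theorem IsSemialgebraicFunOn.kap {N : ℕ} {X : Set (Fin N → ℝ)} {l u w : (Fin N → ℝ) → ℝ}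
    (hX : IsSemialgebraic ℚ X) (hl : IsSemialgebraicFunOn ℚ X l) (hu : IsSemialgebraicFunOn ℚ X u)
    (hw : IsSemialgebraicFunOn ℚ X w) : IsSemialgebraicFunOn ℚ X fun v => kap (l v) (u v) (w v) := by
  have hmin : IsSemialgebraicFunOn ℚ X fun v => min (u v) (w v) :=
    (IsSemialgebraicFunOn.mul_holds (isSemialgebraicFunOn_ratCast hX (1 / 2))
      (IsSemialgebraicFunOn.sub_holds (IsSemialgebraicFunOn.add_holds hu hw)
        (IsSemialgebraicFunOn.sub_holds hu hw).abs)).congr fun v _ => by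
      rw [min_eq_half_abs]
      simp only [Pi.mul_apply, Pi.sub_apply, Pi.add_apply]; push_cast; ring
  exact (IsSemialgebraicFunOn.mul_holds (isSemialgebraicFunOn_ratCast hX (1 / 2))
    (IsSemialgebraicFunOn.add_holds (IsSemialgebraicFunOn.add_holds hl hmin)
      (IsSemialgebraicFunOn.sub_holds hl hmin).abs)).congr fun v _ => by
    rw [show BallCube.kap (l v) (u v) (w v) = max (l v) (min (u v) (w v)) from rfl, max_eq_half_abs]
    simp only [Pi.mul_apply, Pi.sub_apply, Pi.add_apply]; push_cast; ring

namespace Quadric₃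

variable (K : Quadric₃)

/-- The SHIFTED normal form `p(x, y, w + ℓ(x, y))` as a quadric in `(x, y, w)`:
`A w² + (2Aℓ + B) w + p(x, y, ℓ)`. -/
def shiftW (ℓ : Wall) : Quadric₃ :=
  ⟨K.A, 2 * K.A * ℓ.k0 + K.b0, 2 * K.A * ℓ.k1 + K.b1, 2 * K.A * ℓ.k2 + K.b2,
    K.A * ℓ.k0 ^ 2 + K.b0 * ℓ.k0 + K.c0, 2 * K.A * ℓ.k0 * ℓ.k1 + K.b0 * ℓ.k1 + K.b1 * ℓ.k0 + K.c1,
    2 * K.A * ℓ.k0 * ℓ.k2 + K.b0 * ℓ.k2 + K.b2 * ℓ.k0 + K.c2, K.A * ℓ.k1 ^ 2 + K.b1 * ℓ.k1 + K.c11,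
    2 * K.A * ℓ.k1 * ℓ.k2 + K.b1 * ℓ.k2 + K.b2 * ℓ.k1 + K.c12, K.A * ℓ.k2 ^ 2 + K.b2 * ℓ.k2 + K.c22⟩

/-- The shift keeps the square coefficient. [this node] -/
@[simp] theorem shiftW_A (ℓ : Wall) : (K.shiftW ℓ).A = K.A := rfl

/-- `B_ℓ = 2Aℓ + B`. [this node] -/
theorem shiftW_Bxy (ℓ : Wall) (x y : ℝ) : (K.shiftW ℓ).Bxy x y = 2 * K.A * ℓ.eval x y + K.Bxy x y := by
  simp only [shiftW, Bxy, Wall.eval]; push_cast; ring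

/-- `C_ℓ = p ∘ ℓ`. [this node] -/
theorem shiftW_Cxy (ℓ : Wall) (x y : ℝ) : (K.shiftW ℓ).Cxy x y = K.pxyz x y (ℓ.eval x y) := by
  simp only [shiftW, Cxy, pxyz, Bxy, Wall.eval]; push_cast; ring

/-- The shifted form is `p(x, y, w + ℓ)`. [this node] -/
theorem shiftW_pxyz (ℓ : Wall) (x y w : ℝ) :
    (K.shiftW ℓ).pxyz x y w = K.pxyz x y (w + ℓ.eval x y) := by
  simp only [shiftW, pxyz, Bxy, Cxy, Wall.eval]; push_cast; ring

/-- The shift keeps the discriminant. [this node] -/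
theorem shiftW_Dxy (ℓ : Wall) (x y : ℝ) : (K.shiftW ℓ).Dxy x y = K.Dxy x y := by
  rw [Dxy, Dxy, shiftW_Bxy, shiftW_Cxy, shiftW_A, pxyz]; ring

/-- The shift moves `lo` by `−ℓ`. [this node] -/
theorem shiftW_lo (hA : K.A ≠ 0) (ℓ : Wall) (x y : ℝ) :
    (K.shiftW ℓ).lo x y = K.lo x y - ℓ.eval x y := by
  have hA' : (K.A : ℝ) ≠ 0 := by exact_mod_cast hA
  rw [lo_eq, lo_eq, shiftW_Bxy, shiftW_Dxy, shiftW_A]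
  field_simp
  ring

/-- The shift moves `hi` by `−ℓ`. [this node] -/
theorem shiftW_hi (hA : K.A ≠ 0) (ℓ : Wall) (x y : ℝ) :
    (K.shiftW ℓ).hi x y = K.hi x y - ℓ.eval x y := by
  have hA' : (K.A : ℝ) ≠ 0 := by exact_mod_cast hA
  rw [hi_eq, hi_eq, shiftW_Bxy, shiftW_Dxy, shiftW_A]
  field_simp
  ring

/-! #### 31.2 Root regimes against a wall -/

/-- `lo < 0 ↔ B < 0 ∨ C₀ > 0` (for `A < 0`, `D > 0`). [folklore] -/
theorem lo_neg_iff (hA : K.A < 0) {x y : ℝ} (hD : 0 < K.Dxy x y) :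
    K.lo x y < 0 ↔ K.Bxy x y < 0 ∨ 0 < K.Cxy x y := by
  have hA' : (K.A : ℝ) < 0 := by exact_mod_cast hA
  have h2A : (2 : ℝ) * K.A < 0 := by linarith
  rw [lo_eq, div_lt_iff_of_neg h2A, zero_mul]
  have h := hi_pos_aux (B := -K.Bxy x y) (C := K.Cxy x y) hA' (Real.sqrt_pos.2 hD)
    (by rw [Real.sq_sqrt hD.le, Dxy]; ring)
  rw [neg_neg, neg_pos] at h
  exact ⟨fun h' => h.1 (by linarith), fun h' => by linarith [h.2 h']⟩

/-- `hi < 0 ↔ B < 0 ∧ C₀ < 0` (for `A < 0`, `D > 0`). [folklore] -/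
theorem hi_neg_iff (hA : K.A < 0) {x y : ℝ} (hD : 0 < K.Dxy x y) :
    K.hi x y < 0 ↔ K.Bxy x y < 0 ∧ K.Cxy x y < 0 := by
  have hA' : (K.A : ℝ) < 0 := by exact_mod_cast hA
  have h2A : (2 : ℝ) * K.A < 0 := by linarith
  rw [hi_eq, div_lt_iff_of_neg h2A, zero_mul]
  have h := lo_pos_aux (B := -K.Bxy x y) (C := K.Cxy x y) hA' (Real.sqrt_pos.2 hD)
    (by rw [Real.sq_sqrt hD.le, Dxy]; ring)
  rw [neg_neg, neg_pos] at h
  exact ⟨fun h' => h.1 (by linarith), fun h' => by linarith [h.2 h']⟩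

/-- `ℓ < lo ↔ 2Aℓ + B > 0 ∧ p∘ℓ < 0` (for `A < 0`, `D > 0`). [folklore] -/
theorem wall_lt_lo_iff (hA : K.A < 0) (ℓ : Wall) {x y : ℝ} (hD : 0 < K.Dxy x y) :
    ℓ.eval x y < K.lo x y ↔ 0 < (K.shiftW ℓ).Bxy x y ∧ (K.shiftW ℓ).Cxy x y < 0 := by
  rw [show (ℓ.eval x y < K.lo x y) ↔ (0 < (K.shiftW ℓ).lo x y) by rw [K.shiftW_lo hA.ne, sub_pos]]
  exact (K.shiftW ℓ).lo_pos_iff hA (by rwa [shiftW_Dxy])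

/-- `lo < ℓ ↔ 2Aℓ + B < 0 ∨ p∘ℓ > 0` (for `A < 0`, `D > 0`). [folklore] -/
theorem lo_lt_wall_iff (hA : K.A < 0) (ℓ : Wall) {x y : ℝ} (hD : 0 < K.Dxy x y) :
    K.lo x y < ℓ.eval x y ↔ (K.shiftW ℓ).Bxy x y < 0 ∨ 0 < (K.shiftW ℓ).Cxy x y := by
  rw [show (K.lo x y < ℓ.eval x y) ↔ ((K.shiftW ℓ).lo x y < 0) by rw [K.shiftW_lo hA.ne, sub_neg]]
  exact (K.shiftW ℓ).lo_neg_iff hA (by rwa [shiftW_Dxy])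

/-- `ℓ < hi ↔ 2Aℓ + B > 0 ∨ p∘ℓ > 0` (for `A < 0`, `D > 0`). [folklore] -/
theorem wall_lt_hi_iff (hA : K.A < 0) (ℓ : Wall) {x y : ℝ} (hD : 0 < K.Dxy x y) :
    ℓ.eval x y < K.hi x y ↔ 0 < (K.shiftW ℓ).Bxy x y ∨ 0 < (K.shiftW ℓ).Cxy x y := by
  rw [show (ℓ.eval x y < K.hi x y) ↔ (0 < (K.shiftW ℓ).hi x y) by rw [K.shiftW_hi hA.ne, sub_pos]]
  exact (K.shiftW ℓ).hi_pos_iff hA (by rwa [shiftW_Dxy])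

/-- `hi < ℓ ↔ 2Aℓ + B < 0 ∧ p∘ℓ < 0` (for `A < 0`, `D > 0`). [folklore] -/
theorem hi_lt_wall_iff (hA : K.A < 0) (ℓ : Wall) {x y : ℝ} (hD : 0 < K.Dxy x y) :
    K.hi x y < ℓ.eval x y ↔ (K.shiftW ℓ).Bxy x y < 0 ∧ (K.shiftW ℓ).Cxy x y < 0 := by
  rw [show (K.hi x y < ℓ.eval x y) ↔ ((K.shiftW ℓ).hi x y < 0) by rw [K.shiftW_hi hA.ne, sub_neg]]
  exact (K.shiftW ℓ).hi_neg_iff hA (by rwa [shiftW_Dxy])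

end Quadric₃

end Summit.KontsevichZagierPeriods.RootDecompWalshStrata.ConicDescent.BallCube
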